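import Summits.CriticalPhenomena.PercolationContinuityZ3.Theses.PercAnnulusCrossing
import Summits.CriticalPhenomena.PercolationContinuityZ3.Theorems.PercNonProliferationSubpolynomialBlockingStubBlockerRSWGlue
import HarnessLib

/-!
# Crux `PercNonProliferation.SubpolynomialBlocking` (stmt-CriticalPhenomena-4446), line `cross-sandwich-flat-seal` — stub `stub_comparisonOfBlockerRSWOfSeed`

Helper file for the lead's skeleton of the line `cross-sandwich-flat-seal` of the crux
`Summit.CriticalPhenomena.PercolationContinuityZ3.Theses.PercNonProliferation.SubpolynomialBlocking`.
Proves exactly the registered stub signature `stub_comparisonOfBlockerRSWOfSeed`; lands with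
`--supports stmt-CriticalPhenomena-4446`.

Write `seal₀(Icc 0 b)` for "NO open path inside the coordinate box `Icc 0 b ⊆ ℤ³` from its face
`{x₀ = 0}` to its face `{x₀ = n}`", and at `p = p_c(ℤ³)`: `q_n = P(seal₀([0,n]³))` (cube),
`w_n = P(seal₀([0,n] × [0,2n]²))` (wide box), `seed_k(n) = P(seal₀([0,n] × [0, n + ⌊n/k⌋]²))`.
The open stub `stub_comparison` of the line asks for `k ≥ 1`, `C`, `c > 0` with
`c · q_n ^ C ≤ seed_k(n)` eventually. The two sibling route items
`PercAnnulusCrossing.BlockerRSW3D` (stmt-CriticalPhenomena-1129: one monotone `f`, `f > 0` on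
`(0, ∞)`, with `f(q_n(p)) ≤ w_n(p)` for all `p` and `n ≥ 1`) and
`PercAnnulusCrossing.CubeBlockingSeed` (stmt-CriticalPhenomena-1141: `c₀ ≤ q_n(p_c)` for `n ≥ 1`,
`c₀ > 0`) give it TRIVIALLY with `k := 1` (then the seed box `[0,n] × [0, n + n/1]²` IS the wide box),
`C := 0` and `c := f c₀`: for `n ≥ 1`, `f c₀ ≤ f(q_n) ≤ w_n`. The items' `Finset.Icc`/`openConnIn`
spelling of the seal events agrees with the line's `Set.Icc`/`openCrossing` spelling by the landed
`StubBlockerRSWGlue.sealEvent_eq` (p121157). This file records that edge (the companion edge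
`CubeBlockingSeed → stub_anchor` is `stub_anchorOfCubeBlockingSeed`).

No new definitions; no unproved facts are used (both items are HYPOTHESES).
-/

noncomputable section

namespace Summit.CriticalPhenomena.PercolationContinuityZ3.Theorems.SubpolynomialBlocking

open MeasureTheory Filter Topology
open Literature.Probability.Percolation Literature.Probability.LatticeModels
open Summit.CriticalPhenomena.PercolationContinuityZ3.Theses

/-- **Stub `stub_comparisonOfBlockerRSWOfSeed`** (registered signature): the blocker-RSW inequality
(body of the sibling item `PercAnnulusCrossing.BlockerRSW3D`) and the critical cube-blocking seed
(body of `PercAnnulusCrossing.CubeBlockingSeed`), with the `Literature.…` prefixes opened, imply the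
line's open stub `stub_comparison` with `k = 1`, `C = 0`, `c = f c₀`: for `n ≥ 1`,
`f c₀ · q_n ^ 0 = f c₀ ≤ f(q_n) ≤ w_n = seed_1(n)` (the box `[0,n] × [0, n + n/1]²` is the wide box
`[0,n] × [0,2n]²`, `Nat.div_one`/`two_mul`; the two spellings of the seal event agree by
`StubBlockerRSWGlue.sealEvent_eq`). -/
theorem stub_comparisonOfBlockerRSWOfSeed : (∃ f : ℝ → ℝ, Monotone f ∧ (∀ s, 0 < s → 0 < f s) ∧ ∀ (p : unitInterval) (n : ℕ), 1 ≤ n → f ((bondPercolation (zdGraph 3) p).real {ω | ¬ ∃ x ∈ Finset.Icc (0 : Site 3) ![(n : ℤ), n, n], ∃ y ∈ Finset.Icc (0 : Site 3) ![(n : ℤ), n, n], x 0 = 0 ∧ y 0 = n ∧ ω ∈ openConnIn ↑(Finset.Icc (0 : Site 3) ![(n : ℤ), n, n]) x y}) ≤ (bondPercolation (zdGraph 3) p).real {ω | ¬ ∃ x ∈ Finset.Icc (0 : Site 3) ![(n : ℤ), 2 * n, 2 * n], ∃ y ∈ Finset.Icc (0 : Site 3) ![(n : ℤ), 2 * n,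 2 * n], x 0 = 0 ∧ y 0 = n ∧ ω ∈ openConnIn ↑(Finset.Icc (0 : Site 3) ![(n : ℤ), 2 * n, 2 * n]) x y}) → (∃ c : ℝ, 0 < c ∧ ∀ n : ℕ, 1 ≤ n → c ≤ (bondPercolation (zdGraph 3) (criticalProbI 3)).real {ω | ¬ ∃ x ∈ Finset.Icc (0 : Site 3) ![(n : ℤ), n, n], ∃ y ∈ Finset.Icc (0 : Site 3) ![(n : ℤ), n, n], x 0 = 0 ∧ y 0 = n ∧ ω ∈ openConnIn ↑(Finset.Icc (0 : Site 3) ![(n : ℤ), n, n]) x y}) → ∃ k : ℕ, 1 ≤ k ∧ ∃ (C : ℕ) (c : ℝ), 0 < c ∧ ∀ᶠ n : ℕ in atTop, c * (bondPercolation (zdGraph 3) (criticalProbI 3)).real (openCrossing (Set.Icc (0 : Site 3) ![(n : ℤ), (n : ℤ), (n : ℤ)]) {x | x ∈ Set.Icc (0 : Site 3) ![(n : ℤ), (n : ℤ), (n : ℤ)] ∧ x 0 = 0} {y | y ∈ Set.Icc (0 : Site 3) ![(n : ℤ), (n : ℤ), (n : ℤ)] ∧ y 0 = (n : ℤ)})ᶜ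 ^ C ≤ (bondPercolation (zdGraph 3) (criticalProbI 3)).real (openCrossing (Set.Icc (0 : Site 3) ![(n : ℤ), (n : ℤ) + (n / k : ℕ), (n : ℤ) + (n / k : ℕ)]) {x | x ∈ Set.Icc (0 : Site 3) ![(n : ℤ), (n : ℤ) + (n / k : ℕ), (n : ℤ) + (n / k : ℕ)] ∧ x 0 = 0} {y | y ∈ Set.Icc (0 : Site 3) ![(n : ℤ), (n : ℤ) + (n / k : ℕ), (n : ℤ) + (n / k : ℕ)] ∧ y 0 = (n : ℤ)})ᶜ := by
  rintro ⟨f, hf_mono, hf_pos, hf⟩ ⟨c₀, hc₀, hseed⟩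
  refine ⟨1, le_rfl, 0, f c₀, hf_pos c₀ hc₀, ?_⟩
  filter_upwards [eventually_ge_atTop 1] with n hn
  rw [pow_zero, mul_one]
  -- the seed box at aspect `k = 1` is the wide box `[0,n] × [0,2n]²`
  have hv : (![(n : ℤ), (n : ℤ) + (n / 1 : ℕ), (n : ℤ) + (n / 1 : ℕ)] : Site 3) =
      ![(n : ℤ), 2 * n, 2 * n] := by
    -- adapted from `StubBlockerRSWGlue.tiling_one`
    rw [Nat.div_one, two_mul]
  rw [hv, ← StubBlockerRSWGlue.sealEvent_eq]
  -- `f c₀ ≤ f (q_n) ≤ w_n` at `p_c`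
  exact (hf_mono (hseed n hn)).trans (hf (criticalProbI 3) n hn)

namespace StubComparisonOfBlockerRSWOfSeed

/-- The stub read through the sibling route's item names: `PercAnnulusCrossing.BlockerRSW3D`
(stmt-CriticalPhenomena-1129) and `PercAnnulusCrossing.CubeBlockingSeed` (stmt-CriticalPhenomena-1141)
imply the line's stub `stub_comparison` (`∃ k ≥ 1, C, c > 0`, eventually `c · q_n ^ C ≤ seed_k(n)`).
Both items are `def`s whose bodies are the hypotheses of `stub_comparisonOfBlockerRSWOfSeed` verbatim.
This file is a helper of crux stmt-CriticalPhenomena-4446, not a closure of the sibling items. -/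
theorem comparison_of_siblings (h₁ : PercAnnulusCrossing.BlockerRSW3D)
    (h₂ : PercAnnulusCrossing.CubeBlockingSeed) :
    ∃ k : ℕ, 1 ≤ k ∧ ∃ (C : ℕ) (c : ℝ), 0 < c ∧ ∀ᶠ n : ℕ in atTop,
      c * (bondPercolation (zdGraph 3) (criticalProbI 3)).real
          (openCrossing (Set.Icc (0 : Site 3) ![(n : ℤ), (n : ℤ), (n : ℤ)])
            {x | x ∈ Set.Icc (0 : Site 3) ![(n : ℤ), (n : ℤ), (n : ℤ)] ∧ x 0 = 0}
            {y | y ∈ Set.Icc (0 : Site 3) ![(n : ℤ), (n : ℤ), (n : ℤ)] ∧ y 0 = (n : ℤ)})ᶜ ^ C ≤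
        (bondPercolation (zdGraph 3) (criticalProbI 3)).real
          (openCrossing (Set.Icc (0 : Site 3) ![(n : ℤ), (n : ℤ) + (n / k : ℕ), (n : ℤ) + (n / k : ℕ)])
            {x | x ∈ Set.Icc (0 : Site 3) ![(n : ℤ), (n : ℤ) + (n / k : ℕ), (n : ℤ) + (n / k : ℕ)] ∧
              x 0 = 0}
            {y | y ∈ Set.Icc (0 : Site 3) ![(n : ℤ), (n : ℤ) + (n / k : ℕ), (n : ℤ) + (n / k : ℕ)] ∧
              y 0 = (n : ℤ)})ᶜ :=
  stub_comparisonOfBlockerRSWOfSeed h₁ h₂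

end StubComparisonOfBlockerRSWOfSeed

end Summit.CriticalPhenomena.PercolationContinuityZ3.Theorems.SubpolynomialBlocking

end
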